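import Summits.QuantumFields.BalabanUV.Beta.GAN24.FineReadoutCauchyFrame
import Summits.QuantumFields.BalabanUV.Beta.GAN24.StripRegularPackaging
import Summits.QuantumFields.BalabanUV.Beta.GAN24.FibreDetStripHolds

/-!
# `BalabanUV.Beta.GAN24.FineReadoutCauchyOfPieces` — «(N1-Cauchy)» FROM ITS ONE ANALYTIC PIECE: a punctured-strip bound on the difference symbols

**G-an2-4 FORMALISATION SWARM, b2b-balaban-gan24-formalise-leaf-17 (gen 11) — PART S₀ of the located leaf «(N1-Cauchy)»** (holder leaf-17;
division `HOME/b2b-balaban-gan24-formalise-leaf-17/g11/N1-CAUCHY-DIVISION.md`).  NOT IN PRINT; OUR PROOF ATTEMPT.  [folklore] packaging, no analysis.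

HONEST FRAMING (verbatim): «discharging `BetaPertH` makes Bałaban's UV stability UNCONDITIONAL — a real constructive-QFT result;
it is NOT the continuum limit and NOT the Clay problem.»
HONEST DEPENDENCY (verbatim): «continuum YM on T⁴ ⇐ BetaPertH ∧ nine spine estimates (0/9 proved); BetaPertH ⇐ (D1) ∧ (D4) ∧ CAP+tail;
G-an2-4 gates asym, D1 and NE2/3/4.»

## What is here — THE TYPED TARGET OF THE ANALYTIC PARTS (A, K, C of the division)
* §1 `stripHolo_diffSym`: the difference symbol of `GAN24/FineReadoutCauchyFrame` is strip holomorphic wherever the fibre determinants of the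
  two blockings do not vanish (a finite linear combination of inverse-fibre entries; `StripRegularPackaging.stripHolo_fibInv`);
  `continuous_diffSym_ofRealVec`: continuous at every real momentum (no determinant hypothesis, `FibreContinuity`).
* §2 `norm_diffSym_le_of_punctured`: a bound on the PUNCTURED strip `Strip ∖ {0}` holds on the strip (closure at the zero momentum through
  the real diagonal, `FibreContinuity.norm_le_on_BZ_of_punctured'`); `stripRegular_diffSym_of_punctured`.
* §3 **`exists_wH_cellMean_cauchy_of_punctured`** (generic `d`, every `Lc ≥ 1`): IF for some `κ₁ > 0`, `c ≥ 0`, `0 ≤ θ < 1`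
  `∀ n κ l ζ, ∀ p ∈ Strip (d+1) κ₁, p ≠ 0 → ‖diffSym (Lc^(n+1)) (Lc^(n+2)) Lc κ l ζ p‖ ≤ c·θ^n`
  THEN the owner's «(N1-Cauchy)» (`N1-CAUCHY-SPEC.md` §1) holds VERBATIM — the fibre determinants are off zero on a uniform strip at every
  level by road P1's `FibreDetStripHolds.exists_strip` BY NAME, so the only thing the analytic parts must deliver is the displayed
  punctured-strip bound (alias by alias via `GAN24/FineReadoutCauchyFold.diffSym_eq_sum_fold`).
Discharges NOTHING of `(hS, hSall)`; «(N1-Cauchy)» stays OPEN until the displayed bound is a tree theorem.  0 sorry, axioms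
{propext, Classical.choice, Quot.sound}.
-/

noncomputable section

open Complex Finset
open scoped Real BigOperators
open Literature.MathematicalPhysics.QuantumFieldTheory
open Literature.MathematicalPhysics.QuantumFieldTheory.Balaban1983to89
open Literature.MathematicalPhysics.QuantumFieldTheory.Balaban1983to89.Beta
open Literature.Probability.LatticeModels (Site TorusSite Torus.proj)
open LatticeForm (quo)
open B12Sec2to5 (l1)
open B4Strip (Strip ofRealVec)
open B4ContourShift (BZ StripRegular ofRealVec_mem_Strip)
open BlochFibreMatrix (Idx stencil pieceMatrix)
open AffineAveraging (box toSite)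
open KernelSpecInstance (wH)
open Beta.FibreInverseDecay (trigPolySymbol StripHolo stripHolo_const)
open Summit.QuantumFields.BalabanUV.Beta.GAN24.CombesThomasFibre (fibInv)
open Summit.QuantumFields.BalabanUV.Beta.GAN24.FibreContinuity (continuous_fibInv_ofRealVec norm_le_on_BZ_of_punctured')
open Summit.QuantumFields.BalabanUV.Beta.GAN24.StripRegularPackaging (stripHolo_fibInv stripRegular_of_stripHolo)
open Summit.QuantumFields.BalabanUV.Beta.GAN24.FibreDetStripHolds (exists_strip strip_mono)
open Summit.QuantumFields.BalabanUV.Beta.GAN24.FineReadoutCauchyFrame (diffSym exists_wH_cellMean_cauchy_of_strip)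

namespace Summit.QuantumFields.BalabanUV.Beta.GAN24.FineReadoutCauchyOfPieces

variable {d : ℕ}

/-! ## §1 Regularity of the difference symbol -/

/-- [folklore] The difference symbol is strip holomorphic where the fibre determinants of the two blockings are off zero. -/
theorem stripHolo_diffSym (N N' Lc : ℕ) [NeZero N] [NeZero N'] {κ₁ : ℝ} (hκ₁ : 0 ≤ κ₁)
    (hdet : ∀ p ∈ Strip (d + 1) κ₁, (trigPolySymbol (stencil (d + 1)) (pieceMatrix (N := N)) p).det ≠ 0)
    (hdet' : ∀ p ∈ Strip (d + 1) κ₁, (trigPolySymbol (stencil (d + 1)) (pieceMatrix (N := N')) p).det ≠ 0)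
    (κ l : Fin (d + 1)) (z : Site (d + 1)) : StripHolo (diffSym N N' Lc κ l z) κ₁ := by
  have h1 : StripHolo (fun p => (((Lc : ℂ) ^ (d + 1))⁻¹ * ((N' : ℂ) ^ (d + 2))) *
      ∑ r ∈ box (d + 1) Lc, fibInv N' (Sum.inl (κ, Torus.proj N' ((Lc : ℤ) • z + toSite r))) (Sum.inr (Sum.inr l)) p) κ₁ :=
    (stripHolo_const _ κ₁).mul (StripHolo.finset_sum _ fun r _ => stripHolo_fibInv hκ₁ hdet' _ _)
  have h2 : StripHolo (fun p => (-((N : ℂ) ^ (d + 2))) * fibInv N (Sum.inl (κ, Torus.proj N z)) (Sum.inr (Sum.inr l)) p) κ₁ :=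
    (stripHolo_const _ κ₁).mul (stripHolo_fibInv hκ₁ hdet _ _)
  have h := h1.add h2
  have he : diffSym N N' Lc κ l z = fun p => (((Lc : ℂ) ^ (d + 1))⁻¹ * ((N' : ℂ) ^ (d + 2))) *
      ∑ r ∈ box (d + 1) Lc, fibInv N' (Sum.inl (κ, Torus.proj N' ((Lc : ℤ) • z + toSite r))) (Sum.inr (Sum.inr l)) p +
      (-((N : ℂ) ^ (d + 2))) * fibInv N (Sum.inl (κ, Torus.proj N z)) (Sum.inr (Sum.inr l)) p := by
    funext p; unfold diffSym; ring
  rw [he]; exact h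

/-- [folklore] The difference symbol is continuous at every REAL momentum (no determinant hypothesis). -/
theorem continuous_diffSym_ofRealVec (N N' Lc : ℕ) [NeZero N] [NeZero N'] (κ l : Fin (d + 1)) (z : Site (d + 1)) :
    Continuous fun s : Fin (d + 1) → ℝ => diffSym N N' Lc κ l z (ofRealVec s) := by
  unfold diffSym
  exact (continuous_const.mul (continuous_finsetSum _ fun r _ => continuous_fibInv_ofRealVec _ _)).sub
    (continuous_const.mul (continuous_fibInv_ofRealVec _ _))

/-! ## §2 Punctured strip ⇒ strip -/

/-- [folklore] `ofRealVec s = 0 ⇒ s = 0`. -/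
theorem eq_zero_of_ofRealVec_eq_zero {s : Fin (d + 1) → ℝ} (h : ofRealVec s = 0) : s = 0 := by
  funext i
  have := congrFun h i
  simpa [ofRealVec] using this

/-- [folklore] **CLOSURE AT THE ZERO MOMENTUM**: a bound on the punctured strip holds on the strip. -/
theorem norm_diffSym_le_of_punctured (N N' Lc : ℕ) [NeZero N] [NeZero N'] {κ₁ M : ℝ} (hκ₁ : 0 ≤ κ₁) (κ l : Fin (d + 1))
    (z : Site (d + 1)) (hM : ∀ p ∈ Strip (d + 1) κ₁, p ≠ 0 → ‖diffSym N N' Lc κ l z p‖ ≤ M) :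
    ∀ p ∈ Strip (d + 1) κ₁, ‖diffSym N N' Lc κ l z p‖ ≤ M := by
  intro p hp
  by_cases h0 : p = 0
  · subst h0
    have hb : ∀ s ∈ BZ (d + 1), s ≠ 0 → ‖diffSym N N' Lc κ l z (ofRealVec s)‖ ≤ M := fun s hs hs0 =>
      hM _ (ofRealVec_mem_Strip hκ₁ hs) fun h => hs0 (eq_zero_of_ofRealVec_eq_zero h)
    have h := norm_le_on_BZ_of_punctured' (continuous_diffSym_ofRealVec N N' Lc κ l z) hb 0
      ⟨fun _ => by simp [Real.pi_pos.le], fun _ => by simp [Real.pi_pos.le]⟩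
    have e : ofRealVec (0 : Fin (d + 1) → ℝ) = (0 : Fin (d + 1) → ℂ) := by funext i; simp [ofRealVec]
    rwa [e] at h
  · exact hM p hp h0

/-- [folklore] Strip regularity of the difference symbol from determinants off zero and a punctured-strip bound. -/
theorem stripRegular_diffSym_of_punctured (N N' Lc : ℕ) [NeZero N] [NeZero N'] {κ₁ M : ℝ} (hκ₁ : 0 ≤ κ₁)
    (hdet : ∀ p ∈ Strip (d + 1) κ₁, (trigPolySymbol (stencil (d + 1)) (pieceMatrix (N := N)) p).det ≠ 0)
    (hdet' : ∀ p ∈ Strip (d + 1) κ₁, (trigPolySymbol (stencil (d + 1)) (pieceMatrix (N := N')) p).det ≠ 0)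
    (κ l : Fin (d + 1)) (z : Site (d + 1)) (hM : ∀ p ∈ Strip (d + 1) κ₁, p ≠ 0 → ‖diffSym N N' Lc κ l z p‖ ≤ M) :
    StripRegular (diffSym N N' Lc κ l z) κ₁ M :=
  stripRegular_of_stripHolo (stripHolo_diffSym N N' Lc hκ₁ hdet hdet' κ l z) (norm_diffSym_le_of_punctured N N' Lc hκ₁ κ l z hM)

/-! ## §3 «(N1-Cauchy)» from the punctured-strip bound -/

/-- [folklore] **«(N1-Cauchy)» FROM ITS ONE ANALYTIC PIECE** (generic `d`, every `Lc ≥ 1`): a bound `c·θ^n` on the difference symbols of the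
consecutive blockings `Lc^{n+1} ⊂ Lc^{n+2}` on a punctured strip, uniform in `(κ, l, ζ)`, gives the cell-mean convergence of the normalised
minimiser columns with block decay — the owner's `N1-CAUCHY-SPEC.md` §1 VERBATIM.  The fibre determinants are off zero on a uniform strip at
every level by road P1's `FibreDetStripHolds.exists_strip`; the frame is `FineReadoutCauchyFrame.exists_wH_cellMean_cauchy_of_strip`. -/
theorem exists_wH_cellMean_cauchy_of_punctured (Lc : ℕ) [NeZero Lc]
    (h : ∃ κ₁ c θ : ℝ, 0 < κ₁ ∧ 0 ≤ c ∧ 0 ≤ θ ∧ θ < 1 ∧ ∀ (n : ℕ) (κ l : Fin (d + 1)) (ζ : Site (d + 1)),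
      ∀ p ∈ Strip (d + 1) κ₁, p ≠ 0 → ‖diffSym (Lc ^ (n + 1)) (Lc ^ (n + 2)) Lc κ l ζ p‖ ≤ c * θ ^ n) :
    ∃ c' θ' κ' : ℝ, 0 ≤ c' ∧ 0 ≤ θ' ∧ θ' < 1 ∧ 0 < κ' ∧ ∀ (n : ℕ) (κ l : Fin (d + 1)) (z : Fin (d + 1) → ℤ),
      |((Lc : ℝ) ^ (d + 1))⁻¹ * ∑ r ∈ box (d + 1) Lc,
            ((Lc : ℝ) ^ (n + 2)) ^ (d + 2) * wH (N := Lc ^ (n + 2)) κ l ((Lc : ℤ) • z + toSite r) -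
          ((Lc : ℝ) ^ (n + 1)) ^ (d + 2) * wH (N := Lc ^ (n + 1)) κ l z| ≤
        c' * θ' ^ n * Real.exp (-κ' * l1 (quo (Lc ^ (n + 1)) z)) := by
  obtain ⟨κ₁, c, θ, hκ₁, hc, hθ0, hθ1, hD⟩ := h
  obtain ⟨ρ₀, κ₀, A, _hρ₀, hκ₀, _hκρ, _hκ4, _hA, hdet, _hpair⟩ := exists_strip (d := d) (Lc := Lc)
  set κ₂ : ℝ := min κ₁ κ₀ with hκ₂
  have hκ₂0 : 0 < κ₂ := lt_min hκ₁ hκ₀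
  refine exists_wH_cellMean_cauchy_of_strip Lc hκ₂0 hc hθ0 hθ1 fun n κ l z => ?_
  haveI : NeZero (Lc ^ (n + 1)) := ⟨pow_ne_zero _ (NeZero.ne Lc)⟩
  haveI : NeZero (Lc ^ (n + 2)) := ⟨pow_ne_zero _ (NeZero.ne Lc)⟩
  refine stripRegular_diffSym_of_punctured (Lc ^ (n + 1)) (Lc ^ (n + 2)) Lc hκ₂0.le
    (strip_mono (min_le_right κ₁ κ₀) (hdet n)) ?_ κ l z (strip_mono (min_le_left κ₁ κ₀) fun p hp => hD n κ l z p hp)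
  have h2 := hdet (n + 1)
  exact strip_mono (min_le_right κ₁ κ₀) h2

end Summit.QuantumFields.BalabanUV.Beta.GAN24.FineReadoutCauchyOfPieces

end
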